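import Literature.NumberTheory.EllipticCurves.DeShalit1987.FrobeniusTwistReading
import Literature.NumberTheory.EllipticCurves.PAdicOneVariableRelNormCoherentUnitsOfGlobal
import Literature.NumberTheory.NumberFields.RayClassFieldLocalTowerContainmentUnramified
import HarnessLib

/-!
# The canonical `𝔓`-adic reading of a ray class field `K(𝔪)` inside `𝒪_E` (`v ∤ 𝔪`): the localization `𝒪_{F,(𝔓)}` of `𝒪_F`
# (`F = K(𝔪)`) at the prime `𝔓` under the chosen embedding, its embedding `ψ_𝔓 : 𝒪_{F,(𝔓)} → 𝒪_E`, and its Frobenius `σ_v|`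

Topic `NumberTheory/EllipticCurves` (four transparent definitions with their unfolding lemmas, and theorems; no named fact, no instance,
no `sorry`).  De Shalit II §4.1 (2) (p. 55) works with the SEMI-LOCAL completed ring `R = 𝒪_F ⊗_{𝒪_K} 𝒪_𝔭 = ⊕_{𝔓 ∣ 𝔭} 𝒪_𝔓`
(`F = K(𝔣)`), and II §4.2 (p. 56) fixes a Weierstrass model «defined over the localization of `𝒪_F` at `𝔭`».  The measure lane of cell
`bsd-print-cf2` reads global data (elliptic units, the coordinates `x(ξ(Ω))`, `x(ξ(c))`, the constants `Δ(L)/Δ(𝔞⁻¹L)`) into the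
valuation ring `𝒪_E` of a finite unramified `E/K_v` through the chosen embedding `e = absClosureEmbedding K K_v : K̄ → K̄_v`
(`RelNormCoherentUnits.ofGlobal`), and its per-unit seam (`…KatzMeasureJZeroSeamPerUnit.map_relCoatesWiles_eq_of_bridge`, binders
`R, ψ𝔓, φC, hG, hGφ, hQθ`) quantifies over an ABSTRACT data ring `R` with a reading `ψ_𝔓 : R →+* 𝒪_E`.  This file exhibits the canonical
ALGEBRAIC one — the localization `𝒪_{F,(𝔓)} = {y ∈ F : ‖e y‖ ≤ 1}` of `𝒪_F` at the prime `𝔓 ∣ v` cut out by `e`, a dense subring of the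
`𝔓`-COMPONENT `𝒪_𝔓` of de Shalit's semi-local `R` (not `R` itself):

* `DeShalit1987.readingFieldHom E hE : K(𝔪) →+* E` — `e` restricted to `K(𝔪)` and corestricted to any finite normal `E ⊇ e(K(𝔪))`
  (such `E` exist inside `K_v^{nr}`: `adjoin_image_rayClassField_le_maxUnramified`);
* `DeShalit1987.readingRing E hE : Subring K(𝔪)` — **`𝒪_{F,(𝔓)} := {y ∈ K(𝔪) : ‖e y‖ ≤ 1}`**, the preimage of `𝒪_E` (`Subring.comap`)
  (membership `mem_readingRing_iff`; contains the algebraic integers, `mem_readingRing_of_isIntegral`; units = norm one,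
  `isUnit_readingRing_of_norm_eq_one` — the currency of the integrality/unit inputs `hu`, `K ∈ Rˣ` of `DeShalitThetaTExpansionIntegral`);
* `DeShalit1987.readingHom E hE : readingRing E hE →+* unitBall E` — **`ψ_𝔓`**, with `coe_coe_readingHom : ψ_𝔓 r = e r` in `K̄_v` (`rfl`: EXACTLY
  the hypothesis `hψ` of `FrobeniusTwistReading` and the components of `RelNormCoherentUnits.ofGlobal`), injective;
* `DeShalit1987.readingFrob E hE hv𝔪 : readingRing E hE ≃+* readingRing E hE` — **`σ_v|`**, the Artin symbol `galFrob K K(𝔪) v` restricted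
  (it preserves `𝒪_{F,(𝔓)}` BECAUSE it is the local Frobenius, II §4.2 (p. 56) «`φ = σ_𝔭`»:
  `FrobeniusTwistReading.absGaloisRestrict_smul_coe_rayClassField_eq_galFrob`), with `coe_readingFrob`, `coe_readingFrob_symm`;
and instantiates `FrobeniusTwistReading` on them: ★ `frobUnitBall_readingHom` (`φ (ψ_𝔓 r) = ψ_𝔓 (σ_v r)` for EVERY arithmetic Frobenius
`σ₀` of `K_v`), `frobUnitBall_symm_readingHom`, ★ `map_frobUnitBall_map_readingHom` / `map_frobUnitBall_symm_iterate_map_readingHom`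
(power series), ★★ `map_frobUnitBall_map_readingHom_thetaTExpansion` / `map_frobUnitBall_symm_iterate_map_readingHom_thetaTExpansion`
(de Shalit's `φ^{∓n} Q` of II §4.9 (ii) for the algebraic theta `t`-expansion with data in `𝒪_{F,(𝔓)}`).

SCOPE (read before filing facts over this ring): the series `Q(T) = P(λ_Ê(T))` of II §4.9 has coefficients in `F` («`P(z) ∈ F⟦z⟧`»,
p. 62, and `λ_Ê ∈ F⟦T⟧` for an `F`-rational model), so its algebraic form (`DeShalitThetaTExpansionIntegral`, data `x₀, y₀, x_c, K ∈ F`)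
lives over `readingRing` as soon as the data are `𝔓`-integral; de Shalit's COLEMAN power series `g_β ∈ R⟦T⟧ˣ` (II §4.6) have
coefficients in the COMPLETION `𝒪_𝔓` and do NOT live over `readingRing` — nothing about `g_β` should be stated over this ring.
HONEST FRAMING: plumbing for the (e)-assembly of the R3 endpoint of print leaf 24720; nothing here closes a crux; no summit statement is
proved; BSD is not proved by any of this.

## References
* [deShalit1987] E. de Shalit, *Iwasawa theory of elliptic curves with complex multiplication* (1987), II §4.1 (2) (p. 55: the semi-local
  `R = 𝒪_F ⊗ 𝒪_𝔭 = ⊕ 𝒪_𝔓`), II §4.2 (p. 56: the model «over the localization of `𝒪_F` at `𝔭`», `φ = σ_𝔭`), II §4.3 (p. 57: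
  `Φ = K(𝔣)_𝔓 ⊆ K_𝔭^{nr}`), II §4.9 (p. 62–63: `P(z) ∈ F⟦z⟧`, `Q(T) ∈ R⟦T⟧ˣ`, `φ⁻ⁿQ`).
* [SerreLocalFields1979] J.-P. Serre, *Local Fields* (1979), Ch. II §2 Prop. 3 (integral closure = unit ball), Ch. I §8.
* [NeukirchANT1999] J. Neukirch, *Algebraic Number Theory* (1999), Ch. II §8 (primes above `𝔭` ↔ embeddings into `K̄_𝔭`), Ch. VI §7 (7.1).
-/

noncomputable section

open scoped NumberField
open Field IsDedekindDomain ValuativeRel PowerSeries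
open Literature.NumberTheory.GaloisRepresentations Literature.NumberTheory.GaloisRepresentations.IsNonarchimedeanLocalField
  Literature.NumberTheory.GaloisRepresentations.LubinTate Literature.NumberTheory.NumberFields

namespace Literature.NumberTheory.EllipticCurves

namespace DeShalit1987

variable {K : Type} [Field K] [NumberField K] {v : HeightOneSpectrum (𝓞 K)} {𝔪 : Ideal (𝓞 K)}

attribute [local instance] ltNormUniformSpace ltNormIsUniformAddGroup rk1 nF nE fintypeResidueField

variable (E : IntermediateField (v.adicCompletion K) (AlgebraicClosure (v.adicCompletion K)))
  [FiniteDimensional (v.adicCompletion K) E]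
  (hE : ∀ y : AlgebraicClosure K, y ∈ rayClassField K 𝔪 → absClosureEmbedding K (v.adicCompletion K) y ∈ E)

/-! ### The reading of the field `K(𝔪)` in `E` -/

/-- **`e|_{K(𝔪)} : K(𝔪) → E`**: the chosen embedding `K̄ → K̄_v` restricted to the ray class field and corestricted to `E ⊇ e(K(𝔪))`.
[cite: NeukirchANT1999, Ch. II §8 (embeddings into `K̄_𝔭`)] [cite: deShalit1987, II §4.3 (p. 57)] -/
def readingFieldHom : rayClassField K 𝔪 →+* E :=
  RingHom.codRestrict ((absClosureEmbedding K (v.adicCompletion K)).toRingHom.comp (rayClassField K 𝔪).toSubring.subtype) E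
    (fun y ↦ hE y y.2)

omit [FiniteDimensional (v.adicCompletion K) E] in
/-- Unfolding: `(e|_{K(𝔪)} y : K̄_v) = e y`. [cite: NeukirchANT1999, Ch. II §8] -/
@[simp] theorem coe_readingFieldHom (y : rayClassField K 𝔪) :
    ((readingFieldHom E hE y : E) : AlgebraicClosure (v.adicCompletion K)) =
      absClosureEmbedding K (v.adicCompletion K) (y : AlgebraicClosure K) :=
  rfl

omit [FiniteDimensional (v.adicCompletion K) E] in
/-- `e|_{K(𝔪)}` is injective (a ring map out of a field). [cite: NeukirchANT1999, Ch. II §8] -/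
theorem readingFieldHom_injective : Function.Injective (readingFieldHom E hE) :=
  (readingFieldHom E hE).injective

/-! ### The ring `R = {y ∈ K(𝔪) : ‖e y‖ ≤ 1}` and `ψ_𝔓 : R → 𝒪_E` -/

/-- **The localization `𝒪_{F,(𝔓)}`** of `𝒪_F` (`F = K(𝔪)`) at the prime `𝔓 ∣ v` under `e`: the subring of `K(𝔪)` of elements read into the
valuation ring `𝒪_E` — the preimage of `unitBall E` under `e|_{K(𝔪)}`; a dense subring of the `𝔓`-component `𝒪_𝔓` of de Shalit's semi-local
`R = 𝒪_F ⊗ 𝒪_𝔭 = ⊕_{𝔓∣𝔭} 𝒪_𝔓` (not `R` itself). [cite: deShalit1987, II §4.1 (2) (p. 55), II §4.2 (p. 56)] -/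
def readingRing : Subring (rayClassField K 𝔪) :=
  (unitBall E).comap (readingFieldHom E hE)

/-- Membership: `y ∈ 𝒪_{F,(𝔓)} ↔ ‖e y‖ ≤ 1`. [cite: SerreLocalFields1979, Ch. II §2 Prop. 3] [cite: deShalit1987, II §4.2 (p. 56)] -/
theorem mem_readingRing_iff (y : rayClassField K 𝔪) : y ∈ readingRing E hE ↔ ‖(readingFieldHom E hE y : E)‖ ≤ 1 := by
  rw [readingRing, Subring.mem_comap, mem_unitBall_iff]

/-- `y ∈ 𝒪_{F,(𝔓)} ↔ e y ∈ 𝒪_E`. [cite: SerreLocalFields1979, Ch. II §2 Prop. 3] -/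
theorem mem_readingRing_iff_mem_unitBall (y : rayClassField K 𝔪) : y ∈ readingRing E hE ↔ readingFieldHom E hE y ∈ unitBall E :=
  Subring.mem_comap

/-- **Algebraic integers are `𝔓`-integral**: `y ∈ K(𝔪)` integral over `ℤ` lies in `R`. [cite: SerreLocalFields1979, Ch. II §2 Prop. 3] -/
theorem mem_readingRing_of_isIntegral {y : rayClassField K 𝔪} (hy : IsIntegral ℤ (y : AlgebraicClosure K)) : y ∈ readingRing E hE :=
  (mem_readingRing_iff E hE y).mpr (norm_mk_absClosureEmbedding_le_one_of_isIntegral E hy (hE y y.2))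

/-- **`ψ_𝔓 : 𝒪_{F,(𝔓)} → 𝒪_E`**, the `𝔓`-adic reading of the data ring (the inclusion `𝒪_{F,(𝔓)} ⊂ 𝒪_𝔓 ⊆ 𝒪_E` into the `𝔓`-component
of the semi-local ring). [cite: deShalit1987, II §4.1 (2) (p. 55), II §4.9 (p. 62: «This allows us to move from the complex domain to the p-adics»)] -/
def readingHom : readingRing E hE →+* unitBall E :=
  (readingFieldHom E hE).restrict (readingRing E hE) (unitBall E) (fun _ hy ↦ hy)

/-- Unfolding in `E`: `(ψ_𝔓 r : E) = e|_{K(𝔪)} r`. [cite: deShalit1987, II §4.9] -/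
@[simp] theorem coe_readingHom (r : readingRing E hE) :
    ((readingHom E hE r : unitBall E) : E) = readingFieldHom E hE (r : rayClassField K 𝔪) :=
  rfl

/-- ★ Unfolding in `K̄_v`: **`ψ_𝔓 r = e r`** — the hypothesis `hψ` of `FrobeniusTwistReading` and the shape of the components of
`RelNormCoherentUnits.ofGlobal`, by `rfl`. [cite: deShalit1987, II §4.9] -/
theorem coe_coe_readingHom (r : readingRing E hE) :
    (((readingHom E hE r : unitBall E) : E) : AlgebraicClosure (v.adicCompletion K)) =
      absClosureEmbedding K (v.adicCompletion K) (((r : rayClassField K 𝔪) : AlgebraicClosure K)) :=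
  rfl

/-- `ψ_𝔓` is injective. [cite: deShalit1987, II §4.9] -/
theorem readingHom_injective : Function.Injective (readingHom E hE) := by
  intro r s h
  apply Subtype.ext
  apply readingFieldHom_injective E hE
  exact congrArg (fun z : unitBall E ↦ (z : E)) h

/-- **Units of `R` are the elements of norm one**: if `‖e y‖ = 1` then `y ∈ Rˣ` (its inverse in `K(𝔪)` also has norm `1 ≤ 1`) — the currency of
the `𝔓`-adic units `℘(Ω, L) − ℘(v, L)`, `Δ(L)`, `Δ(𝔞⁻¹L)` of the proof of II.4.9 (i). [cite: deShalit1987, II §4.9 Proposition (i) (proof, p. 62–63)] -/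
theorem isUnit_readingRing_of_norm_eq_one (r : readingRing E hE) (h : ‖(readingFieldHom E hE (r : rayClassField K 𝔪) : E)‖ = 1) : IsUnit r := by
  have hr0 : (r : rayClassField K 𝔪) ≠ 0 := by
    intro h0
    rw [h0, map_zero, norm_zero] at h
    exact zero_ne_one h
  have hinv : (r : rayClassField K 𝔪)⁻¹ ∈ readingRing E hE := by
    rw [mem_readingRing_iff, map_inv₀]
    have : ((readingFieldHom E hE (r : rayClassField K 𝔪))⁻¹ : E) = ((readingFieldHom E hE (r : rayClassField K 𝔪) : E))⁻¹ := rfl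
    rw [norm_inv, h, inv_one]
  refine ⟨⟨r, ⟨_, hinv⟩, Subtype.ext (mul_inv_cancel₀ hr0), Subtype.ext (inv_mul_cancel₀ hr0)⟩, rfl⟩

/-- Conversely a unit of `R` has norm one. [cite: deShalit1987, II §4.9 Proposition (i)] -/
theorem norm_eq_one_of_isUnit_readingRing {r : readingRing E hE} (h : IsUnit r) : ‖(readingFieldHom E hE (r : rayClassField K 𝔪) : E)‖ = 1 := by
  obtain ⟨u, rfl⟩ := h
  have h1 : ‖(readingFieldHom E hE ((u : readingRing E hE) : rayClassField K 𝔪) : E)‖ ≤ 1 := (mem_readingRing_iff E hE _).mp u.val.2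
  have h2 : ‖(readingFieldHom E hE ((↑u⁻¹ : readingRing E hE) : rayClassField K 𝔪) : E)‖ ≤ 1 := (mem_readingRing_iff E hE _).mp u.inv.2
  have hmul : (readingFieldHom E hE ((u : readingRing E hE) : rayClassField K 𝔪) : E) *
      (readingFieldHom E hE ((↑u⁻¹ : readingRing E hE) : rayClassField K 𝔪) : E) = 1 := by
    rw [← map_mul, ← Subring.coe_mul, Units.mul_inv, Subring.coe_one, map_one]
  have h3 : ‖(readingFieldHom E hE ((u : readingRing E hE) : rayClassField K 𝔪) : E)‖ *
      ‖(readingFieldHom E hE ((↑u⁻¹ : readingRing E hE) : rayClassField K 𝔪) : E)‖ = 1 := by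
    rw [← norm_mul, hmul, norm_one]
  nlinarith [norm_nonneg (readingFieldHom E hE ((u : readingRing E hE) : rayClassField K 𝔪) : E),
    norm_nonneg (readingFieldHom E hE ((↑u⁻¹ : readingRing E hE) : rayClassField K 𝔪) : E)]

/-! ### The Frobenius `σ_v|_R` -/

variable [Normal (v.adicCompletion K) E] (h𝔪 : 𝔪 ≠ ⊥) (hv𝔪 : ¬ 𝔪 ≤ v.asIdeal)

include h𝔪 hv𝔪

/-- **`σ_v` read in `E` is a local Frobenius**: for an arithmetic Frobenius `σ₀` of `K_v` and `y ∈ R`,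
`e|_{K(𝔪)} (σ_v y) = φ_{σ₀} (ψ_𝔓 y)` in `E` (`FrobeniusTwistReading`). [cite: deShalit1987, II §4.2 (p. 56: `φ = σ_𝔭`), II §4.4 (p. 58)] [cite: NeukirchANT1999, Ch. VI §7 Thm. (7.1)] -/
theorem readingFieldHom_galFrob_eq {σ₀ : absoluteGaloisGroup (v.adicCompletion K)} (hσ₀ : IsAbsArithFrob σ₀) (r : readingRing E hE) :
    readingFieldHom E hE (galFrob K (rayClassField K 𝔪) v (r : rayClassField K 𝔪)) =
      ((frobUnitBall E σ₀ (readingHom E hE r) : unitBall E) : E) := by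
  apply Subtype.ext
  rw [coe_readingFieldHom, coe_coe_frobUnitBall, coe_coe_readingHom, ← absGaloisRestrict_smul_coe_rayClassField_eq_galFrob h𝔪 hv𝔪 hσ₀,
    absGaloisRestrict_apply_smul]

/-- `σ_v⁻¹` read in `E` is the inverse local Frobenius. [cite: deShalit1987, II §4.9 (ii)] [cite: NeukirchANT1999, Ch. VI §7 Thm. (7.1)] -/
theorem readingFieldHom_galFrob_symm_eq {σ₀ : absoluteGaloisGroup (v.adicCompletion K)} (hσ₀ : IsAbsArithFrob σ₀) (r : readingRing E hE) :
    readingFieldHom E hE ((galFrob K (rayClassField K 𝔪) v).symm (r : rayClassField K 𝔪)) =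
      (((frobUnitBall E σ₀).symm (readingHom E hE r) : unitBall E) : E) := by
  apply Subtype.ext
  rw [coe_readingFieldHom, coe_coe_frobUnitBall_symm, coe_coe_readingHom,
    ← absGaloisRestrict_inv_smul_coe_rayClassField_eq_galFrob_symm h𝔪 hv𝔪 hσ₀,
    ← map_inv (absGaloisRestrict K (v.adicCompletion K)) σ₀, absGaloisRestrict_apply_smul]

/-- `σ_v` preserves `R` (it is an isometry for `‖e ·‖`: the image is the value of `φ` on an element of `𝒪_E`). [cite: deShalit1987, II §4.9 (ii)] -/
theorem galFrob_mem_readingRing (r : readingRing E hE) : galFrob K (rayClassField K 𝔪) v (r : rayClassField K 𝔪) ∈ readingRing E hE := by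
  obtain ⟨σ₀, hσ₀⟩ := exists_isAbsArithFrob_holds (v.adicCompletion K)
  rw [mem_readingRing_iff_mem_unitBall, readingFieldHom_galFrob_eq E hE h𝔪 hv𝔪 hσ₀]
  exact (frobUnitBall E σ₀ (readingHom E hE r)).2

/-- `σ_v⁻¹` preserves `R`. [cite: deShalit1987, II §4.9 (ii)] -/
theorem galFrob_symm_mem_readingRing (r : readingRing E hE) :
    (galFrob K (rayClassField K 𝔪) v).symm (r : rayClassField K 𝔪) ∈ readingRing E hE := by
  obtain ⟨σ₀, hσ₀⟩ := exists_isAbsArithFrob_holds (v.adicCompletion K)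
  rw [mem_readingRing_iff_mem_unitBall, readingFieldHom_galFrob_symm_eq E hE h𝔪 hv𝔪 hσ₀]
  exact ((frobUnitBall E σ₀).symm (readingHom E hE r)).2

/-- **`σ_v|_R : R ≃+* R`** — the Artin symbol `(v, K(𝔪)/K)` restricted to the data ring (de Shalit's `σ_𝔭` acting on `F`, whose
`𝔓`-adic reading is `φ`). [cite: deShalit1987, II §4.2 (p. 56: `φ = σ_𝔭`), II §4.9 (ii)] -/
def readingFrob : readingRing E hE ≃+* readingRing E hE where
  toFun r := ⟨galFrob K (rayClassField K 𝔪) v (r : rayClassField K 𝔪), galFrob_mem_readingRing E hE h𝔪 hv𝔪 r⟩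
  invFun r := ⟨(galFrob K (rayClassField K 𝔪) v).symm (r : rayClassField K 𝔪), galFrob_symm_mem_readingRing E hE h𝔪 hv𝔪 r⟩
  left_inv r := Subtype.ext ((galFrob K (rayClassField K 𝔪) v).symm_apply_apply _)
  right_inv r := Subtype.ext ((galFrob K (rayClassField K 𝔪) v).apply_symm_apply _)
  map_mul' r s := Subtype.ext (by simp only [Subring.coe_mul, map_mul])
  map_add' r s := Subtype.ext (by simp only [Subring.coe_add, map_add])

/-- Unfolding: `(σ_v|_R r : K(𝔪)) = σ_v r`. [cite: deShalit1987, II §4.9 (ii)] -/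
@[simp] theorem coe_readingFrob (r : readingRing E hE) :
    ((readingFrob E hE h𝔪 hv𝔪 r : readingRing E hE) : rayClassField K 𝔪) = galFrob K (rayClassField K 𝔪) v (r : rayClassField K 𝔪) :=
  rfl

/-- Unfolding: `((σ_v|_R)⁻¹ r : K(𝔪)) = σ_v⁻¹ r`. [cite: deShalit1987, II §4.9 (ii)] -/
@[simp] theorem coe_readingFrob_symm (r : readingRing E hE) :
    (((readingFrob E hE h𝔪 hv𝔪).symm r : readingRing E hE) : rayClassField K 𝔪) =
      (galFrob K (rayClassField K 𝔪) v).symm (r : rayClassField K 𝔪) :=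
  rfl

/-- Powers: `((σ_v|_R)ⁿ r : K(𝔪)) = σ_vⁿ r` (as iterates). [cite: deShalit1987, II §4.9 (ii)] -/
theorem coe_readingFrob_symm_pow (n : ℕ) (r : readingRing E hE) :
    ((((readingFrob E hE h𝔪 hv𝔪).symm : readingRing E hE →+* readingRing E hE) ^ n) r : rayClassField K 𝔪) =
      (fun z ↦ (galFrob K (rayClassField K 𝔪) v).symm z)^[n] (r : rayClassField K 𝔪) := by
  induction n generalizing r with
  | zero => rfl
  | succ n ih => rw [pow_succ, RingHom.mul_def, RingHom.comp_apply, ih, Function.iterate_succ_apply]; rfl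

/-! ### `FrobeniusTwistReading` instantiated on `(R, ψ_𝔓, σ_v|_R)` -/

/-- ★ **`φ (ψ_𝔓 r) = ψ_𝔓 (σ_v r)`** for every arithmetic Frobenius `σ₀` of `K_v`. [cite: deShalit1987, II §4.2 (p. 56: `φ = σ_𝔭`), II §4.9 (ii)] -/
theorem frobUnitBall_readingHom {σ₀ : absoluteGaloisGroup (v.adicCompletion K)} (hσ₀ : IsAbsArithFrob σ₀) (r : readingRing E hE) :
    frobUnitBall E σ₀ (readingHom E hE r) = readingHom E hE (readingFrob E hE h𝔪 hv𝔪 r) :=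
  frobUnitBall_apply_eq_galFrob_of_reading E h𝔪 hv𝔪 hσ₀ (readingHom E hE) (fun r ↦ (r : rayClassField K 𝔪))
    (coe_coe_readingHom E hE) (σR := fun r ↦ readingFrob E hE h𝔪 hv𝔪 r) (fun _ ↦ rfl) r

/-- ★ **`φ⁻¹ (ψ_𝔓 r) = ψ_𝔓 (σ_v⁻¹ r)`**. [cite: deShalit1987, II §4.9 (ii)] -/
theorem frobUnitBall_symm_readingHom {σ₀ : absoluteGaloisGroup (v.adicCompletion K)} (hσ₀ : IsAbsArithFrob σ₀) (r : readingRing E hE) :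
    (frobUnitBall E σ₀).symm (readingHom E hE r) = readingHom E hE ((readingFrob E hE h𝔪 hv𝔪).symm r) :=
  frobUnitBall_symm_apply_eq_galFrob_symm_of_reading E h𝔪 hv𝔪 hσ₀ (readingHom E hE) (fun r ↦ (r : rayClassField K 𝔪))
    (coe_coe_readingHom E hE) (τR := fun r ↦ (readingFrob E hE h𝔪 hv𝔪).symm r) (fun _ ↦ rfl) r

/-- As ring maps: `φ ∘ ψ_𝔓 = ψ_𝔓 ∘ σ_v|_R`. [cite: deShalit1987, II §4.9 (ii)] -/
theorem frobUnitBall_comp_readingHom {σ₀ : absoluteGaloisGroup (v.adicCompletion K)} (hσ₀ : IsAbsArithFrob σ₀) :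
    (frobUnitBall E σ₀ : unitBall E →+* unitBall E).comp (readingHom E hE) =
      (readingHom E hE).comp (readingFrob E hE h𝔪 hv𝔪 : readingRing E hE →+* readingRing E hE) :=
  RingHom.ext fun r ↦ frobUnitBall_readingHom E hE h𝔪 hv𝔪 hσ₀ r

/-- ★ On power series: **`(Q^{ψ_𝔓})^{φ} = (Q^{σ_v})^{ψ_𝔓}`**. [cite: deShalit1987, II §4.9 Proposition (ii)] -/
theorem map_frobUnitBall_map_readingHom {σ₀ : absoluteGaloisGroup (v.adicCompletion K)} (hσ₀ : IsAbsArithFrob σ₀)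
    (Q : PowerSeries (readingRing E hE)) :
    PowerSeries.map (frobUnitBall E σ₀ : unitBall E →+* unitBall E) (PowerSeries.map (readingHom E hE) Q) =
      PowerSeries.map (readingHom E hE) (PowerSeries.map (readingFrob E hE h𝔪 hv𝔪 : readingRing E hE →+* readingRing E hE) Q) :=
  map_frobUnitBall_map_eq_galFrob_of_reading E h𝔪 hv𝔪 hσ₀ (readingHom E hE) (fun r ↦ (r : rayClassField K 𝔪))
    (coe_coe_readingHom E hE) (σR := (readingFrob E hE h𝔪 hv𝔪 : readingRing E hE →+* readingRing E hE)) (fun _ ↦ rfl) Q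

/-- ★ On power series, inverse iterate: **`(φ⁻¹)^{n} (Q^{ψ_𝔓}) = (Q^{(σ_v⁻¹)^n})^{ψ_𝔓}`** — the series
`(map (frobUnitBall E σ₀).symm)^[m+1] G` of `relColemanSeries_eq_subst_subst_of_forall_evS` for `G = Q^{ψ_𝔓}`.
[cite: deShalit1987, II §4.9 Proposition (ii)] -/
theorem map_frobUnitBall_symm_iterate_map_readingHom {σ₀ : absoluteGaloisGroup (v.adicCompletion K)} (hσ₀ : IsAbsArithFrob σ₀)
    (n : ℕ) (Q : PowerSeries (readingRing E hE)) :
    (PowerSeries.map ((frobUnitBall E σ₀).symm : unitBall E →+* unitBall E))^[n] (PowerSeries.map (readingHom E hE) Q) =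
      PowerSeries.map (readingHom E hE)
        (PowerSeries.map (((readingFrob E hE h𝔪 hv𝔪).symm : readingRing E hE →+* readingRing E hE) ^ n) Q) :=
  map_frobUnitBall_symm_iterate_map_eq_galFrob_of_reading E h𝔪 hv𝔪 hσ₀ (readingHom E hE) (fun r ↦ (r : rayClassField K 𝔪))
    (coe_coe_readingHom E hE) (τR := ((readingFrob E hE h𝔪 hv𝔪).symm : readingRing E hE →+* readingRing E hE)) (fun _ ↦ rfl) n Q

/-- ★★ **`(Q_R^{ψ_𝔓})^{φ} = Q_R(σ_v-data)^{ψ_𝔓}`** for the algebraic theta `t`-expansion with data `(W; x₀, y₀, x_c, K)` in `R`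
(`DeShalitThetaTExpansionIntegral`): the hypothesis `hGφ` of `…KatzMeasureJZeroSeamPerUnit.map_frob_relCoatesWiles_eq_of_bridge` from its `hG`
with `ψ𝔓 := readingHom`, the conjugate data being `(W^{σ_v}; σ_v x₀, σ_v y₀, σ_v x_c, σ_v K)`. [cite: deShalit1987, II §4.9 Proposition (ii), II §4.2 (p. 56)] -/
theorem map_frobUnitBall_map_readingHom_thetaTExpansion {σ₀ : absoluteGaloisGroup (v.adicCompletion K)} (hσ₀ : IsAbsArithFrob σ₀)
    (W : WeierstrassCurve (readingRing E hE)) (x₀ y₀ : readingRing E hE) {ι : Type*} (T : Finset ι) (x : ι → readingRing E hE)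
    (u : ι → (readingRing E hE)ˣ) (Kc : readingRing E hE) (hu : ∀ c ∈ T, (u c : readingRing E hE) = x₀ - x c) :
    PowerSeries.map (frobUnitBall E σ₀ : unitBall E →+* unitBall E)
        (PowerSeries.map (readingHom E hE)
          (C Kc * ∏ c ∈ T, PowerSeries.invOfUnit ((W.translateX x₀ y₀).subst W.formalNeg - C (x c)) (u c) ^ 6)) =
      PowerSeries.map (readingHom E hE) (C (readingFrob E hE h𝔪 hv𝔪 Kc) * ∏ c ∈ T, PowerSeries.invOfUnit
        (((W.map (readingFrob E hE h𝔪 hv𝔪 : readingRing E hE →+* readingRing E hE)).translateX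
            (readingFrob E hE h𝔪 hv𝔪 x₀) (readingFrob E hE h𝔪 hv𝔪 y₀)).subst
          (W.map (readingFrob E hE h𝔪 hv𝔪 : readingRing E hE →+* readingRing E hE)).formalNeg - C (readingFrob E hE h𝔪 hv𝔪 (x c)))
        (Units.map ((readingFrob E hE h𝔪 hv𝔪 : readingRing E hE →+* readingRing E hE) : readingRing E hE →* readingRing E hE) (u c)) ^ 6) :=
  map_frobUnitBall_map_thetaTExpansion_eq E h𝔪 hv𝔪 hσ₀ (readingHom E hE) (fun r ↦ (r : rayClassField K 𝔪))
    (coe_coe_readingHom E hE) (σR := (readingFrob E hE h𝔪 hv𝔪 : readingRing E hE →+* readingRing E hE)) (fun _ ↦ rfl)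
    W x₀ y₀ T x u Kc hu

/-- ★★ **de Shalit's `φ⁻ⁿ Q` on the canonical reading**: `(φ⁻¹)^{n} (Q_R^{ψ_𝔓}) = Q_R((σ_v⁻¹)^n-data)^{ψ_𝔓}`.
[cite: deShalit1987, II §4.9 Proposition (ii) and its proof (p. 62–63)] -/
theorem map_frobUnitBall_symm_iterate_map_readingHom_thetaTExpansion {σ₀ : absoluteGaloisGroup (v.adicCompletion K)}
    (hσ₀ : IsAbsArithFrob σ₀) (n : ℕ)
    (W : WeierstrassCurve (readingRing E hE)) (x₀ y₀ : readingRing E hE) {ι : Type*} (T : Finset ι) (x : ι → readingRing E hE)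
    (u : ι → (readingRing E hE)ˣ) (Kc : readingRing E hE) (hu : ∀ c ∈ T, (u c : readingRing E hE) = x₀ - x c) :
    (PowerSeries.map ((frobUnitBall E σ₀).symm : unitBall E →+* unitBall E))^[n]
        (PowerSeries.map (readingHom E hE)
          (C Kc * ∏ c ∈ T, PowerSeries.invOfUnit ((W.translateX x₀ y₀).subst W.formalNeg - C (x c)) (u c) ^ 6)) =
      PowerSeries.map (readingHom E hE)
        (C ((((readingFrob E hE h𝔪 hv𝔪).symm : readingRing E hE →+* readingRing E hE) ^ n) Kc) * ∏ c ∈ T, PowerSeries.invOfUnit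
          (((W.map (((readingFrob E hE h𝔪 hv𝔪).symm : readingRing E hE →+* readingRing E hE) ^ n)).translateX
              ((((readingFrob E hE h𝔪 hv𝔪).symm : readingRing E hE →+* readingRing E hE) ^ n) x₀)
              ((((readingFrob E hE h𝔪 hv𝔪).symm : readingRing E hE →+* readingRing E hE) ^ n) y₀)).subst
            (W.map (((readingFrob E hE h𝔪 hv𝔪).symm : readingRing E hE →+* readingRing E hE) ^ n)).formalNeg -
            C ((((readingFrob E hE h𝔪 hv𝔪).symm : readingRing E hE →+* readingRing E hE) ^ n) (x c)))
          (Units.map (((((readingFrob E hE h𝔪 hv𝔪).symm : readingRing E hE →+* readingRing E hE) ^ n :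
            readingRing E hE →+* readingRing E hE)) : readingRing E hE →* readingRing E hE) (u c)) ^ 6) :=
  map_frobUnitBall_symm_iterate_map_thetaTExpansion_eq E h𝔪 hv𝔪 hσ₀ (readingHom E hE) (fun r ↦ (r : rayClassField K 𝔪))
    (coe_coe_readingHom E hE) (τR := ((readingFrob E hE h𝔪 hv𝔪).symm : readingRing E hE →+* readingRing E hE)) (fun _ ↦ rfl)
    n W x₀ y₀ T x u Kc hu

end DeShalit1987

end Literature.NumberTheory.EllipticCurves

end
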